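import Summits.Ventures.WeilGRH.TwistedGramCellSignsA
import HarnessLib

/-!
# GRH arm (rh-explicit, venture WeilGRH): the character-weighted prime constant `A_χ` with the floors `⌊2a/log k⌋` given BY HAND, and an
  elementary floor lemma for half-log windows

Cell `rh-explicit`, WEIL TRACK — GRH ARM (weil-grh-1, gen9).  weil-grh-2's door-E kit certifies the floors `n_k = ⌊2a/log k⌋` of the prime-constant term
`A_χ(a) = Σ_k |Re χ(k)|·Λ(k)k^{-1/2}·2cos(π/(n_k+2))` by interval arithmetic (`TwistedEncl.checkFloors`, consumed by `TwistedEncl.mem_aopBoxW`).  At the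
half-log windows `a = (log b)/2` some quotient `2a/log k = log b/log k` is an EXACT integer whenever `b` is a power of `k` (`(log 8)/2`: `log 8/log 2 = 3`;
`log 3 = (log 9)/2`: `log 9/log 3 = 2`), and an interval check cannot decide the floor.  This file supplies (i) `mem_aopBoxW_of_floors` — weil-grh-2's
`mem_aopBoxW` with the hypothesis `checkFloors C ns = true` replaced by the floor equalities themselves (proof verbatim otherwise), and (ii)
`floor_log_div_mul_log` — `⌊log b / (e·log p)⌋₊ = n` from `p^{e n} ≤ b < p^{e (n+1)}`, the elementary source of those equalities.  Consumed by the
principal cells at `(log 8)/2` (`…PrincipalMod51Log8`) and `log 3` (`…PrincipalMod69Log9`, `…Mod127Log9`, `…Mod131Log9`).  No definitions; no named facts;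
standard axioms.

## References

* H. Yoshida, *On Hermitian forms attached to zeta functions*, Adv. Stud. Pure Math. 21 (1992) 281–325, §7 pp. 305–312. [Yoshida1992HermitianForms]
* R. E. Moore, *Interval Analysis* (1966), Ch. 3. [Moore1966]
(Re-landed unchanged by weil-grh-1 gen10 to re-trigger the hub build; declarations byte-identical.)
-/

set_option autoImplicit false

open Real Finset
open scoped BigOperators ArithmeticFunction.vonMangoldt

namespace Summit.Ventures.WeilGRH

open Literature.NumberTheory.LFunctions Literature.NumberTheory.LFunctions.Yoshida1992
open Literature.NumberTheory.LFunctions.Yoshida1992.Encl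
open Literature.Analysis.SpecialFunctions Literature.Analysis.ValidatedNumerics.NumericsMP

namespace TwistedEncl

variable {S : ℕ} {a : ℝ} {q : ℕ}

/-- ★ **`mem_aopBoxW` with the floors given by hand**: prime data, valid constants, prime signs `Re χ(k_i) = ε_i`, the floor equalities
`⌊2a/ℓ_i⌋₊ = n_i`, and `aopBoxW … = some AOPW` ⇒ `A_χ(a) ∈ AOPW`. [cite: Yoshida1992HermitianForms, §7 pp. 305–312] -/
theorem mem_aopBoxW_of_floors (hS : 0 < S) {ks : List PrimeLen} (hks : PrimeData a ks) {C : Consts}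
    (hC : ConstsValid S a ks C) (χ : DirichletCharacter ℂ q) {εs : List ℤ}
    (hε : ∀ i < ks.length, (χ (((ks.getD i default).val : ℕ) : ZMod q)).re = ((εs.getD i 0 : ℤ) : ℝ))
    {K k : ℕ} {ns : List ℕ} (hfl : ∀ i < ks.length, ⌊2 * a / (ks.getD i default).len⌋₊ = ns.getD i 0) {AOPW : MI}
    (h : aopBoxW S K k C ns εs = some AOPW) :
    MI.mem S (∑ j ∈ weilPrimeIndex a, |(χ (j : ZMod q)).re| *
      ((Λ j : ℝ) / Real.sqrt j * (2 * Real.cos (π / (⌊2 * a / Real.log j⌋₊ + 2))))) AOPW := by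
  have hsum : (∑ j ∈ weilPrimeIndex a, |(χ (j : ZMod q)).re| *
        ((Λ j : ℝ) / Real.sqrt j * (2 * Real.cos (π / (⌊2 * a / Real.log j⌋₊ + 2))))) =
      ∑ j ∈ Finset.range ks.length, |((εs.getD j 0 : ℤ) : ℝ)| *
        ((ks.getD j default).wt * (2 * Real.cos (π / ((ns.getD j 0 : ℕ) + 2)))) := by
    have e1 : (∑ j ∈ weilPrimeIndex a, |(χ (j : ZMod q)).re| *
        ((Λ j : ℝ) / Real.sqrt j * (2 * Real.cos (π / (⌊2 * a / Real.log j⌋₊ + 2))))) =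
        ∑ j ∈ weilPrimeIndex a, (Λ j : ℝ) / Real.sqrt j *
          (|(χ (j : ZMod q)).re| * (2 * Real.cos (π / (⌊2 * a / Real.log j⌋₊ + 2)))) :=
      Finset.sum_congr rfl fun j _ ↦ by ring
    rw [e1, sum_weilPrimeIndex_eq_listSum hks (fun j ↦ |(χ (j : ZMod q)).re| * (2 * Real.cos (π / (⌊2 * a / Real.log j⌋₊ + 2)))),
      list_sum_map_eq_sum_range]
    refine Finset.sum_congr rfl fun j hj ↦ ?_
    have hj' := Finset.mem_range.mp hj
    rw [PrimeLen.log_val, hfl j hj', hε j hj']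
    ring
  rw [hsum]
  unfold aopBoxW at h
  rw [hC.wts_len] at h
  exact mem_aopSumW hS hC ns εs ks.length le_rfl h

/-- **Floors at half-log windows by integer comparison**: `⌊log b / (e·log p)⌋₊ = n` whenever `p^{e·n} ≤ b < p^{e·(n+1)}` (`p ≥ 2`, `e ≥ 1`, `b ≥ 1`) —
this is `⌊2a/ℓ_{p^e}⌋₊` at the window `a = (log b)/2`, exact integer boundaries included. [folklore] -/
theorem floor_log_div_mul_log {p e n b : ℕ} (hp : 1 < p) (he : 0 < e) (hb : 0 < b) (hlo : p ^ (e * n) ≤ b) (hhi : b < p ^ (e * (n + 1))) :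
    ⌊Real.log b / ((e : ℕ) * Real.log (p : ℕ))⌋₊ = n := by
  have hp1 : (1 : ℝ) < p := by exact_mod_cast hp
  have hlp : 0 < Real.log p := Real.log_pos hp1
  have he' : (0 : ℝ) < e := by exact_mod_cast he
  have hden : 0 < (e : ℝ) * Real.log p := mul_pos he' hlp
  have hb1 : (1 : ℝ) ≤ b := by exact_mod_cast hb
  have hlo' : (n : ℝ) * ((e : ℝ) * Real.log p) ≤ Real.log b := by
    rw [show (n : ℝ) * ((e : ℝ) * Real.log p) = Real.log ((p : ℝ) ^ (e * n)) by rw [Real.log_pow]; push_cast; ring]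
    exact Real.log_le_log (by positivity) (by exact_mod_cast hlo)
  have hhi' : Real.log b < ((n : ℝ) + 1) * ((e : ℝ) * Real.log p) := by
    rw [show ((n : ℝ) + 1) * ((e : ℝ) * Real.log p) = Real.log ((p : ℝ) ^ (e * (n + 1))) by rw [Real.log_pow]; push_cast; ring]
    exact Real.log_lt_log (by positivity) (by exact_mod_cast hhi)
  rw [Nat.floor_eq_iff (div_nonneg (Real.log_nonneg hb1) hden.le)]
  exact ⟨by rw [le_div_iff₀ hden]; linarith, by rw [div_lt_iff₀ hden]; linarith⟩

/-- The same with the window written as `2·((log b)/2)`. [folklore] -/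
theorem floor_two_mul_halfLog_div {p e n b : ℕ} (hp : 1 < p) (he : 0 < e) (hb : 0 < b) (hlo : p ^ (e * n) ≤ b)
    (hhi : b < p ^ (e * (n + 1))) :
    ⌊2 * (Real.log b / 2) / ((e : ℕ) * Real.log (p : ℕ))⌋₊ = n := by
  rw [show 2 * (Real.log (b : ℝ) / 2) = Real.log b by ring]
  exact floor_log_div_mul_log hp he hb hlo hhi

end TwistedEncl

end Summit.Ventures.WeilGRH
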